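import Summits.AnomalousDissipation.AnomalousDissipation.Theses.TwoAndHalfD
import Literature.Analysis.FluidPDE.TwoHalfNavierStokes
import Literature.Analysis.FluidPDE.LongTimeAverageNonneg
import Literature.Analysis.FluidPDE.DoeringFoiasProofs
import Literature.Analysis.FluidPDE.AlexakisDoeringProofs
import Literature.Analysis.FluidPDE.LongTimeAverageSlidingWindow

/-!
# Stub `stub_quietOfSubLog` (S5) of the line `log-kantorovich-enstrophy-transfer`
# (crux stmt-AnomalousDissipation-0211, `TwoAndHalfD.TwohalfdNeg`)

**Below `o(log(1/ν))` mean planar strain, releases are finite-window quiet**: the engine S4 (release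
bound `κ∫₀ᵀ‖∇θ‖² ≤ C(S+1)/log(1/κ)` for every weak release of `h` into a drift `u ∈ L^∞L²` with
window strain `∫₀ᵀ‖∇u‖₂ ≤ S`, `κ ≤ κ₀`, `T ≤ T₀`), taken as a HYPOTHESIS, plus sub-logarithmic mean
strain `⟨‖∇v_j‖₂⟩/log(1/ν_j) → 0` of a planar Leray–Hopf family give `⟨ν_j∫₀^S‖∇ϑ_{j,s}‖²⟩_s → 0`
for the releases `ϑ j s` of a fixed smooth `h` at times `s > 0` into `v_j(s + ·)`.

Proof (the lead's five steps). (1) `toReal_eScalarDissipation_release_le`: for `ν ≤ κ₀`, `s > 0`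
apply the engine with `κ = ν`, `T = T₀ = S+1`, `u = v(s + ·)` — in `L^∞(0,S+1;L²)` by the
transported Leray–Hopf energy bound, with the honest (finite: `u ∈ L²H¹`, `√x ≤ 1 + x`) window strain
`W(s) = ∫⁻_{(0,S+1)} (‖∇v(s+τ)‖₂²)^{1/2} dτ` as budget — and monotonicity of the lower integral in the
window: `D(s) ≤ C(W(s).toReal + 1)/ℓ`, `ℓ = log(1/ν) > 0`. (2) Running means are monotone under this
domination, junk included (a non-measurable `D` has Bochner mean `0`). (3)–(4)
`eventually_timeMean_windowStrain_le`: sliding windows (Tonelli, `timeMean_toReal_window_le` of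
`Literature/Analysis/FluidPDE/LongTimeAverageSlidingWindow.lean`) and `limsup` bookkeeping give
eventually `⟨W⟩_T ≤ 2(S+1)(Ψ + 1)`, `Ψ = ⟨‖∇v‖₂⟩` the HONEST `limsup` mean strain: the running means
of `‖∇v‖₂` are bounded at fixed `ν` by the energy inequality with the spectral Poincaré–Young bound
on the power injected by the MEAN-ZERO force `g` (`Torus.IsLerayHopfOn.intervalIntegral_power_bounds`;
no zero-mean hypothesis on `v`, no uniform-in-time energy bound). Hence `longTimeAvgSup_release_le`:
`⟨D⟩ ≤ (C/ℓ)(2(S+1)(Ψ+1) + 1)`. (5) `stub_quietOfSubLog`: `ν_j ≤ κ₀` eventually, `1/ℓ_j → 0`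
(`ν_j → 0⁺`) and `Ψ_j/ℓ_j → 0`, so the bound tends to `0`; squeeze with `⟨D_j⟩ ≥ 0`.

References: skeleton `Cruxes/TwohalfdNeg/Lines/log-kantorovich-enstrophy-transfer.lean` (S5);
Doering–Foias, J. Fluid Mech. 467 (2002) §2 (a-priori bounds on running means).
-/

-- `Summit.<Summit>.<Problem>` is the tree's mandated summit-side namespace (CONVENTIONS §2); for this
-- single-conjunct summit the two coincide, so the duplicate is deliberate.
set_option linter.dupNamespace false

noncomputable section

namespace Summit.AnomalousDissipation.AnomalousDissipation.Theorems.TwohalfdNeg.QuietOfSubLog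

open MeasureTheory Filter Topology
open scoped ENNReal NNReal
open Literature.Analysis.FunctionSpaces Literature.Analysis.FluidPDE

/-! ## Window-strain facts for a global Leray–Hopf solution (any dimension) -/

section WindowStrain

open Set

variable {d : Type*} [Fintype d] [DecidableEq d] {ν : ℝ}
  {f : ℝ → UnitAddTorus d → EuclideanSpace ℝ d} {F u₀ : UnitAddTorus d → EuclideanSpace ℝ d}
  {u : ℝ → UnitAddTorus d → EuclideanSpace ℝ d}

/-- Along a global Leray–Hopf solution, `t ↦ ‖∇u(t)‖₂²` (`Torus.eGradNormSq`) is a.e.-measurable on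
`(0, ∞)` (glue the a.e.-measurability on the intervals `(0, n)`). [folklore] -/
theorem aemeasurable_eGradNormSq_Ioi (hu : Torus.IsGlobalLerayHopf ν f u₀ u) :
    AEMeasurable (fun t => Torus.eGradNormSq (u t)) (volume.restrict (Ioi 0)) := by
  rw [Torus.Ioi_zero_eq_iUnion_Ioo_nat, aemeasurable_iUnion_iff]
  intro n
  rcases Nat.eq_zero_or_pos n with hn | hn
  · subst hn; simp
  · exact (hu n (by exact_mod_cast hn)).aemeasurable_eGradNormSq

/-- Along a global Leray–Hopf solution the `L¹`-in-time strain over `(0, T)` is finite: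
`∫⁻_{(0,T)} (‖∇u‖₂²)^{1/2} ≤ T + ∫⁻_{(0,T)} ‖∇u‖₂² < ∞` (`√x ≤ 1 + x`, `u ∈ L²(0,T;H¹)`). [folklore] -/
theorem lintegral_rpow_half_eGradNormSq_lt_top (hu : Torus.IsGlobalLerayHopf ν f u₀ u) {T : ℝ}
    (hT : 0 < T) : ∫⁻ t in Ioo 0 T, Torus.eGradNormSq (u t) ^ (1 / 2 : ℝ) < ∞ := by
  -- `x^{1/2} ≤ 1 + x` in `[0, ∞]` (cf. `ennreal_rpow_half_le_one_add` of `NSVelocityUniqueness`)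
  have hle : ∀ x : ℝ≥0∞, x ^ (1 / 2 : ℝ) ≤ 1 + x := fun x => by
    rcases le_total x 1 with hx | hx
    · exact (ENNReal.rpow_le_one hx (by norm_num)).trans le_self_add
    · calc x ^ (1 / 2 : ℝ) ≤ x ^ (1 : ℝ) := ENNReal.rpow_le_rpow_of_exponent_le hx (by norm_num)
        _ = x := ENNReal.rpow_one x
        _ ≤ 1 + x := le_add_self
  calc ∫⁻ t in Ioo 0 T, Torus.eGradNormSq (u t) ^ (1 / 2 : ℝ)
      ≤ ∫⁻ t in Ioo 0 T, (1 + Torus.eGradNormSq (u t)) := lintegral_mono fun t => hle _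
    _ = volume (Ioo (0 : ℝ) T) + ∫⁻ t in Ioo 0 T, Torus.eGradNormSq (u t) := by
        rw [lintegral_add_left measurable_const, setLIntegral_const, one_mul]
    _ < ∞ := ENNReal.add_lt_top.2 ⟨measure_Ioo_lt_top, (hu T hT).lintegral_eGradNormSq_lt_top⟩

/-- **The windowed strain is finite**: for `s ≥ 0` and `c > 0`,
`∫⁻_{(0,c)} (‖∇u(s + τ)‖₂²)^{1/2} dτ = ∫⁻_{(s,s+c)} ‖∇u‖₂ < ∞`. [folklore] -/
theorem lintegral_window_rpow_half_lt_top (hu : Torus.IsGlobalLerayHopf ν f u₀ u) {s c : ℝ}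
    (hs : 0 ≤ s) (hc : 0 < c) :
    ∫⁻ τ in Ioo 0 c, Torus.eGradNormSq (u (s + τ)) ^ (1 / 2 : ℝ) < ∞ := by
  have h := setLIntegral_Ioo_add_left (fun t => Torus.eGradNormSq (u t) ^ (1 / 2 : ℝ)) 0 c s
  simp only [add_zero] at h
  rw [h]
  exact (lintegral_mono_set (Ioo_subset_Ioo hs le_rfl)).trans_lt
    (lintegral_rpow_half_eGradNormSq_lt_top hu (by linarith))

/-- **The translated drift is in `L^∞(0,c;L²)`**: for `s ≥ 0`, `c > 0` there is `M` with
`∫ ‖u(s + t)‖² ≤ M` for a.e. `t ∈ (0, c)` (the field `energy_bound` on `(0, s + c)`, transported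
along `t ↦ s + t`). [folklore] -/
theorem exists_ae_energy_bound_translate (hu : Torus.IsGlobalLerayHopf ν f u₀ u) {s c : ℝ}
    (hs : 0 ≤ s) (hc : 0 < c) :
    ∃ M : ℝ≥0, ∀ᵐ t ∂(volume.restrict (Ioo 0 c)), ∫⁻ x, ‖u (s + t) x‖ₑ ^ 2 ≤ M := by
  obtain ⟨M, hM⟩ := (hu (s + c) (by linarith)).energy_bound
  refine ⟨M, ae_restrict_Ioo_add_left (P := fun t => ∫⁻ x, ‖u t x‖ₑ ^ 2 ≤ M) s ?_⟩
  rw [add_zero]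
  exact ae_restrict_of_ae_restrict_of_subset (Ioo_subset_Ioo hs le_rfl) hM

/-- **Eventually bounded running means of the strain `‖∇u‖₂`** for a global Leray–Hopf solution with
steady MEAN-ZERO force `F ∈ L²` and `ν > 0`: for `T ≥ 1`,
`⟨√Z⟩_T ≤ √⟨Z⟩_T ≤ √(‖u₀‖₂²/ν + ‖F‖₂²/(4π²ν²))`, `Z = (‖∇u‖₂²).toReal` — Jensen
(`timeMean_sqrt_le_sqrt_timeMean`) and the Doering–Foias a-priori bound `∫₀ᵀ νZ ≤ 2E₀ + 2AT`
(`Torus.IsLerayHopfOn.intervalIntegral_power_bounds`: the energy inequality with the spectral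
Poincaré–Young bound on the injected power; no zero-mean hypothesis on `u`). This is what makes the
`limsup` mean strain `⟨‖∇u‖₂⟩` honest. [cite: DoeringFoias2002, §2] -/
theorem isBoundedUnder_timeMean_sqrt_eGradNormSq (hu : Torus.IsGlobalLerayHopf ν (fun _ => F) u₀ u)
    (hν : 0 < ν) (hF : MemLp F 2 volume) (hF0 : Torus.HasZeroMean F) :
    IsBoundedUnder (· ≤ ·) atTop
      (timeMean fun t => Real.sqrt (Torus.eGradNormSq (u t)).toReal) := by
  set E₀ : ℝ := Torus.kineticEnergy u₀
  set A : ℝ := (4 * Real.pi ^ 2 * ν)⁻¹ / 2 * ∫ x, ‖F x‖ ^ 2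
  have hE₀ : 0 ≤ E₀ := Torus.kineticEnergy_nonneg u₀
  refine ⟨Real.sqrt (2 * E₀ / ν + 2 * A / ν), ?_⟩
  rw [eventually_map]
  filter_upwards [eventually_ge_atTop (1 : ℝ)] with T hT1
  have hT : 0 < T := by linarith
  -- the Doering–Foias bound on `⟨Z⟩_T`
  obtain ⟨h1, -⟩ := (hu T hT).intervalIntegral_power_bounds hT hν hF hF0
  rw [intervalIntegral.integral_const_mul] at h1
  have hIle : ∫ t in (0 : ℝ)..T, (Torus.eGradNormSq (u t)).toReal ≤ (2 * E₀ + 2 * A * T) / ν := by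
    rw [le_div_iff₀ hν, mul_comm]
    exact h1
  have hZmean : timeMean (fun t => (Torus.eGradNormSq (u t)).toReal) T ≤ 2 * E₀ / ν + 2 * A / ν := by
    have hTinv : T⁻¹ ≤ 1 := inv_le_one_of_one_le₀ hT1
    have h2 : 2 * E₀ / ν * T⁻¹ ≤ 2 * E₀ / ν :=
      (mul_le_mul_of_nonneg_left hTinv (by positivity)).trans_eq (mul_one _)
    unfold timeMean
    calc T⁻¹ * ∫ t in (0 : ℝ)..T, (Torus.eGradNormSq (u t)).toReal
        ≤ T⁻¹ * ((2 * E₀ + 2 * A * T) / ν) := mul_le_mul_of_nonneg_left hIle (inv_nonneg.2 hT.le)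
      _ = 2 * E₀ / ν * T⁻¹ + 2 * A / ν := by field_simp
      _ ≤ 2 * E₀ / ν + 2 * A / ν := by linarith
  -- Jensen
  have hZi : IntegrableOn (fun t => (Torus.eGradNormSq (u t)).toReal) (Ioc 0 T) := by
    rw [integrableOn_Ioc_iff_integrableOn_Ioo]
    exact integrable_toReal_of_lintegral_ne_top (hu T hT).aemeasurable_eGradNormSq
      (hu T hT).lintegral_eGradNormSq_lt_top.ne
  exact (timeMean_sqrt_le_sqrt_timeMean hT (fun t => ENNReal.toReal_nonneg) hZi).trans
    (Real.sqrt_le_sqrt hZmean)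

/-- **The running means of the windowed strain are eventually bounded by the mean strain** (global
Leray–Hopf, steady mean-zero force `F ∈ L²`, `ν > 0`, window `c > 0`): eventually in `T`,
`⟨(∫⁻_{(0,c)} (‖∇u(· + τ)‖₂²)^{1/2} dτ).toReal⟩_T ≤ 2c (⟨‖∇u‖₂⟩ + 1)`,
`⟨‖∇u‖₂⟩ = longTimeAvgSup (t ↦ √((‖∇u(t)‖₂²).toReal))`: sliding windows
`⟨W⟩_T ≤ c(T+c)/T · ⟨‖∇u‖₂⟩_{T+c}` (`timeMean_toReal_window_le`, Tonelli), `(T+c)/T ≤ 2` for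
`T ≥ c`, and `⟨‖∇u‖₂⟩_{T+c} ≤ ⟨‖∇u‖₂⟩ + 1` eventually (honest: bounded running means). [folklore] -/
theorem eventually_timeMean_windowStrain_le (hu : Torus.IsGlobalLerayHopf ν (fun _ => F) u₀ u)
    (hν : 0 < ν) (hF : MemLp F 2 volume) (hF0 : Torus.HasZeroMean F) {c : ℝ} (hc : 0 < c) :
    ∀ᶠ T in atTop,
      timeMean (fun s => (∫⁻ τ in Ioo 0 c, Torus.eGradNormSq (u (s + τ)) ^ (1 / 2 : ℝ)).toReal) T ≤
        2 * c * (longTimeAvgSup (fun t => Real.sqrt (Torus.eGradNormSq (u t)).toReal) + 1) := by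
  set φ : ℝ → ℝ≥0∞ := fun t => Torus.eGradNormSq (u t) ^ (1 / 2 : ℝ) with hφ
  set ψ : ℝ → ℝ := fun t => Real.sqrt (Torus.eGradNormSq (u t)).toReal with hψ
  have hφm : AEMeasurable φ (volume.restrict (Ioi 0)) := (aemeasurable_eGradNormSq_Ioi hu).pow_const _
  have hφψ : (fun t => (φ t).toReal) = ψ := by
    funext t
    simp only [hφ, hψ]
    rw [← ENNReal.toReal_rpow, Real.sqrt_eq_rpow]
  have hψ0 : ∀ t, 0 ≤ ψ t := fun t => Real.sqrt_nonneg _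
  have hbdd : IsBoundedUnder (· ≤ ·) atTop (timeMean ψ) :=
    isBoundedUnder_timeMean_sqrt_eGradNormSq hu hν hF hF0
  filter_upwards [eventually_shift_le_limsup_add hbdd c one_pos, eventually_ge_atTop c] with T hT hTc
  have hT0 : 0 < T := hc.trans_le hTc
  have hfin : ∫⁻ t in Ioo 0 (T + c), φ t ≠ ∞ :=
    (lintegral_rpow_half_eGradNormSq_lt_top hu (by linarith)).ne
  have hwin := timeMean_toReal_window_le hφm hc.le hT0 hfin
  rw [hφψ] at hwin
  have hm0 : 0 ≤ timeMean ψ (T + c) := timeMean_nonneg hψ0 (by linarith)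
  have hratio : c * (T + c) / T ≤ 2 * c := by
    rw [div_le_iff₀ hT0]
    nlinarith
  calc timeMean (fun s => (∫⁻ τ in Ioo 0 c, φ (s + τ)).toReal) T
      ≤ c * (T + c) / T * timeMean ψ (T + c) := hwin
    _ ≤ 2 * c * timeMean ψ (T + c) := mul_le_mul_of_nonneg_right hratio hm0
    _ ≤ 2 * c * (longTimeAvgSup ψ + 1) := mul_le_mul_of_nonneg_left hT (by positivity)

end WindowStrain

/-! ## Steps 1–4 for one planar Leray–Hopf solution -/

section PerSolution

variable {ν κ₀ C H L S : ℝ} {g : UnitAddTorus (Fin 2) → EuclideanSpace ℝ (Fin 2)}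
  {v₀ : UnitAddTorus (Fin 2) → EuclideanSpace ℝ (Fin 2)}
  {v : ℝ → UnitAddTorus (Fin 2) → EuclideanSpace ℝ (Fin 2)} {h : UnitAddTorus (Fin 2) → ℝ}

/-- **Step 1 — one release.** Under the engine bound (S4 on `T²`: constants `κ₀ < 1`, `C ≥ 0` for
the profile bounds `H, L` and the maximal window `S + 1`), for a global Leray–Hopf drift `v` with
`0 < ν ≤ κ₀` and a weak release `ϑ` of `h` at time `s > 0` into `v(s + ·)` on `[0, S+1)`:
`(ν∫₀^S‖∇ϑ‖²).toReal ≤ C (W(s).toReal + 1)/log(1/ν)`, `W(s) = ∫⁻_{(0,S+1)} (‖∇v(s+τ)‖₂²)^{1/2} dτ`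
(finite, so an honest budget; the drift is in `L^∞L²` by the transported energy bound; the
dissipation on `(0,S)` is at most that on `(0,S+1)`). [folklore] -/
theorem toReal_eScalarDissipation_release_le (hκ₀1 : κ₀ < 1) (hC : 0 ≤ C) (hS : 0 < S)
    (hmain : ∀ (κ T S' : ℝ) (u : ℝ → UnitAddTorus (Fin 2) → EuclideanSpace ℝ (Fin 2))
        (h' : UnitAddTorus (Fin 2) → ℝ) (θ : ℝ → UnitAddTorus (Fin 2) → ℝ),
        0 < κ → κ ≤ κ₀ → 0 < T → T ≤ S + 1 → 0 ≤ S' →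
        (∃ M : ℝ≥0, ∀ᵐ t ∂(volume.restrict (Set.Ioo 0 T)), ∫⁻ x, ‖u t x‖ₑ ^ 2 ≤ M) →
        ∫⁻ t in Set.Ioo 0 T, Torus.eGradNormSq (u t) ^ (1 / 2 : ℝ) ≤ ENNReal.ofReal S' →
        Torus.IsSmooth h' → (∀ x, |h' x| ≤ H) → (∀ x, ‖Torus.gradient h' x‖ ≤ L) →
        Torus.IsWeakScalarTransportOn T κ u h' θ →
        Torus.eScalarDissipation κ θ 0 T ≤ ENNReal.ofReal (C * (S' + 1) / Real.log κ⁻¹))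
    (hν : 0 < ν) (hνκ : ν ≤ κ₀) (hLH : Torus.IsGlobalLerayHopf ν (fun _ => g) v₀ v)
    (hhs : Torus.IsSmooth h) (hH : ∀ x, |h x| ≤ H) (hL : ∀ x, ‖Torus.gradient h x‖ ≤ L)
    {ϑ : ℝ → UnitAddTorus (Fin 2) → ℝ} {s : ℝ} (hs : 0 < s)
    (hrel : Torus.IsWeakScalarTransportOn (S + 1) ν (fun τ => v (s + τ)) h ϑ) :
    (Torus.eScalarDissipation ν ϑ 0 S).toReal ≤
      C * ((∫⁻ τ in Set.Ioo 0 (S + 1), Torus.eGradNormSq (v (s + τ)) ^ (1 / 2 : ℝ)).toReal + 1) /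
        Real.log ν⁻¹ := by
  set W := ∫⁻ τ in Set.Ioo 0 (S + 1), Torus.eGradNormSq (v (s + τ)) ^ (1 / 2 : ℝ) with hW
  have hWlt : W < ∞ := lintegral_window_rpow_half_lt_top hLH hs.le (by linarith)
  have hstrain : ∫⁻ t in Set.Ioo 0 (S + 1),
      Torus.eGradNormSq ((fun τ => v (s + τ)) t) ^ (1 / 2 : ℝ) ≤ ENNReal.ofReal W.toReal := by
    rw [ENNReal.ofReal_toReal hWlt.ne]
  obtain ⟨M, hM⟩ := exists_ae_energy_bound_translate hLH hs.le (by linarith : (0 : ℝ) < S + 1)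
  have hlog : 0 < Real.log ν⁻¹ := Real.log_pos ((one_lt_inv₀ hν).2 (hνκ.trans_lt hκ₀1))
  have hB : 0 ≤ C * (W.toReal + 1) / Real.log ν⁻¹ := by positivity
  have h1 := hmain ν (S + 1) W.toReal (fun τ => v (s + τ)) h ϑ hν hνκ (by linarith) le_rfl
    ENNReal.toReal_nonneg ⟨M, hM⟩ hstrain hhs hH hL hrel
  have hmono : Torus.eScalarDissipation ν ϑ 0 S ≤ Torus.eScalarDissipation ν ϑ 0 (S + 1) := by
    unfold Torus.eScalarDissipation
    exact mul_le_mul' le_rfl (lintegral_mono_set (Set.Ioo_subset_Ioo_right (by linarith)))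
  calc (Torus.eScalarDissipation ν ϑ 0 S).toReal
      ≤ (ENNReal.ofReal (C * (W.toReal + 1) / Real.log ν⁻¹)).toReal :=
        ENNReal.toReal_mono ENNReal.ofReal_ne_top (hmono.trans h1)
    _ = C * (W.toReal + 1) / Real.log ν⁻¹ := ENNReal.toReal_ofReal hB

/-- **Steps 2–4 — one drift, all release times.** Under the engine bound, for a global Leray–Hopf
drift `v` with smooth mean-zero steady force `g`, viscosity `0 < ν ≤ κ₀`, and weak releases `ϑ s` of
`h` at every time `s > 0` into `v(s + ·)` on `[0, S+1)`:
`⟨(ν∫₀^S‖∇ϑ_s‖²).toReal⟩_s ≤ (C/log(1/ν)) · (2(S+1)(⟨‖∇v‖₂⟩ + 1) + 1)`,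
`⟨‖∇v‖₂⟩ = longTimeAvgSup (t ↦ √((‖∇v(t)‖₂²).toReal))`. Step 2: running means are monotone under
the domination of Step 1, junk included; Steps 3–4: the running means of the window strain are
eventually `≤ 2(S+1)(⟨‖∇v‖₂⟩ + 1)` (`Torus.IsGlobalLerayHopf.eventually_timeMean_windowStrain_le`:
sliding windows + honest `limsup`, the running means of `‖∇v‖₂` being bounded for a mean-zero
force). [folklore] -/
theorem longTimeAvgSup_release_le (hκ₀1 : κ₀ < 1) (hC : 0 ≤ C) (hS : 0 < S)
    (hmain : ∀ (κ T S' : ℝ) (u : ℝ → UnitAddTorus (Fin 2) → EuclideanSpace ℝ (Fin 2))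
        (h' : UnitAddTorus (Fin 2) → ℝ) (θ : ℝ → UnitAddTorus (Fin 2) → ℝ),
        0 < κ → κ ≤ κ₀ → 0 < T → T ≤ S + 1 → 0 ≤ S' →
        (∃ M : ℝ≥0, ∀ᵐ t ∂(volume.restrict (Set.Ioo 0 T)), ∫⁻ x, ‖u t x‖ₑ ^ 2 ≤ M) →
        ∫⁻ t in Set.Ioo 0 T, Torus.eGradNormSq (u t) ^ (1 / 2 : ℝ) ≤ ENNReal.ofReal S' →
        Torus.IsSmooth h' → (∀ x, |h' x| ≤ H) → (∀ x, ‖Torus.gradient h' x‖ ≤ L) →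
        Torus.IsWeakScalarTransportOn T κ u h' θ →
        Torus.eScalarDissipation κ θ 0 T ≤ ENNReal.ofReal (C * (S' + 1) / Real.log κ⁻¹))
    (hν : 0 < ν) (hνκ : ν ≤ κ₀) (hgs : Torus.IsSmooth g) (hgz : Torus.HasZeroMean g)
    (hLH : Torus.IsGlobalLerayHopf ν (fun _ => g) v₀ v)
    (hhs : Torus.IsSmooth h) (hH : ∀ x, |h x| ≤ H) (hL : ∀ x, ‖Torus.gradient h x‖ ≤ L)
    {ϑ : ℝ → ℝ → UnitAddTorus (Fin 2) → ℝ}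
    (hrel : ∀ s : ℝ, 0 < s → Torus.IsWeakScalarTransportOn (S + 1) ν (fun τ => v (s + τ)) h (ϑ s)) :
    longTimeAvgSup (fun s => (Torus.eScalarDissipation ν (ϑ s) 0 S).toReal) ≤
      C / Real.log ν⁻¹ *
        (2 * (S + 1) * (longTimeAvgSup (fun t => Real.sqrt (Torus.eGradNormSq (v t)).toReal) + 1)
          + 1) := by
  set ℓ := Real.log ν⁻¹ with hℓ
  set Ψ := longTimeAvgSup (fun t => Real.sqrt (Torus.eGradNormSq (v t)).toReal) with hΨ
  set Wf : ℝ → ℝ := fun s =>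
    (∫⁻ τ in Set.Ioo 0 (S + 1), Torus.eGradNormSq (v (s + τ)) ^ (1 / 2 : ℝ)).toReal with hWf
  set D : ℝ → ℝ := fun s => (Torus.eScalarDissipation ν (ϑ s) 0 S).toReal with hD
  have hD0 : ∀ s, 0 ≤ D s := fun s => ENNReal.toReal_nonneg
  have hlog : 0 < ℓ := Real.log_pos ((one_lt_inv₀ hν).2 (hνκ.trans_lt hκ₀1))
  have hCℓ : 0 ≤ C / ℓ := div_nonneg hC hlog.le
  have hc : (0 : ℝ) < S + 1 := by linarith
  have hev := eventually_timeMean_windowStrain_le hLH hν (hgs.memLp 2) hgz hc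
  refine longTimeAvgSup_le_of_eventually_le hD0 ?_
  filter_upwards [hev, eventually_gt_atTop (0 : ℝ)] with T hT hT0
  have hWi : IntegrableOn Wf (Set.Ioc 0 T) :=
    integrableOn_toReal_window (φ := fun t => Torus.eGradNormSq (v t) ^ (1 / 2 : ℝ))
      ((aemeasurable_eGradNormSq_Ioi hLH).pow_const _)
      (lintegral_rpow_half_eGradNormSq_lt_top hLH (by linarith)).ne
  have h1i : IntegrableOn (fun _ => (1 : ℝ)) (Set.Ioc 0 T) := integrableOn_const measure_Ioc_lt_top.ne
  have hBi : IntegrableOn (fun s => C / ℓ * (Wf s + 1)) (Set.Ioc 0 T) := (hWi.add h1i).const_mul _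
  have hcmp : timeMean D T ≤ timeMean (fun s => C / ℓ * (Wf s + 1)) T := by
    refine timeMean_le_timeMean_of_nonneg_of_le hT0.le (fun s _ => hD0 s) (fun s hs => ?_) hBi
    have h1 := toReal_eScalarDissipation_release_le hκ₀1 hC hS hmain hν hνκ hLH hhs hH hL hs.1
      (hrel s hs.1)
    calc D s ≤ C * (Wf s + 1) / ℓ := h1
      _ = C / ℓ * (Wf s + 1) := by ring
  have hBmean : timeMean (fun s => C / ℓ * (Wf s + 1)) T = C / ℓ * (timeMean Wf T + 1) := by
    rw [timeMean_const_mul]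
    congr 1
    simp only [timeMean, intervalIntegral.integral_of_le hT0.le]
    rw [integral_add hWi h1i, setIntegral_const, Real.volume_real_Ioc_of_le hT0.le, sub_zero,
      smul_eq_mul, mul_one, mul_add, inv_mul_cancel₀ hT0.ne']
  calc timeMean D T ≤ timeMean (fun s => C / ℓ * (Wf s + 1)) T := hcmp
    _ = C / ℓ * (timeMean Wf T + 1) := hBmean
    _ ≤ C / ℓ * (2 * (S + 1) * (Ψ + 1) + 1) :=
        mul_le_mul_of_nonneg_left (by linarith [hT]) hCℓ

end PerSolution

/-! ## Step 5 — the stub -/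

/-- **S5 `stub_quietOfSubLog` — below `o(log(1/ν))` mean planar strain, releases are finite-window
quiet.** HYPOTHESES: the release bound of S4 (instantiated on `T²`); a smooth divergence-free
mean-zero steady `g`; `ν_j → 0`; global Leray–Hopf `v_j` (force `g`) with bounded mean energy whose
limsup-mean strain is sub-logarithmic, `⟨‖∇v_j‖_{L²}⟩/log(1/ν_j) → 0`. CONCLUSION: for every smooth
mean-zero `h`, every `S > 0` and every family of weak releases `ϑ j s` of `h` at times `s > 0` into
`v_j` (weak on `[0,S+1)`), the long-time mean over `s` of the age-`S` dissipation tends to `0`.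
Proof: `H = sup|h|`, `L = sup‖∇h‖` (continuous on the compact torus), `T₀ = S + 1`; for `j` large
`ν_j ≤ κ₀` and `longTimeAvgSup_release_le` bounds the `j`-th mean by
`(C/log(1/ν_j))(2(S+1)(Ψ_j + 1) + 1) → 0` (`Ψ_j/log(1/ν_j) → 0` by hypothesis, `1/log(1/ν_j) → 0`
because `ν_j → 0⁺`); squeeze with nonnegativity. The energy ceiling and `div g = 0` are not used at
this step (they feed S6). [folklore] -/
theorem stub_quietOfSubLog :
    (∀ (H L T₀ : ℝ), 0 < T₀ →
      ∃ κ₀ C : ℝ, 0 < κ₀ ∧ κ₀ < 1 ∧ 0 ≤ C ∧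
        ∀ (κ T S : ℝ) (u : ℝ → UnitAddTorus (Fin 2) → EuclideanSpace ℝ (Fin 2))
          (h : UnitAddTorus (Fin 2) → ℝ) (θ : ℝ → UnitAddTorus (Fin 2) → ℝ),
          0 < κ → κ ≤ κ₀ → 0 < T → T ≤ T₀ → 0 ≤ S →
          (∃ M : ℝ≥0, ∀ᵐ t ∂(volume.restrict (Set.Ioo 0 T)), ∫⁻ x, ‖u t x‖ₑ ^ 2 ≤ M) →
          ∫⁻ t in Set.Ioo 0 T, Torus.eGradNormSq (u t) ^ (1 / 2 : ℝ) ≤ ENNReal.ofReal S →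
          Torus.IsSmooth h → (∀ x, |h x| ≤ H) → (∀ x, ‖Torus.gradient h x‖ ≤ L) →
          Torus.IsWeakScalarTransportOn T κ u h θ →
          Torus.eScalarDissipation κ θ 0 T ≤ ENNReal.ofReal (C * (S + 1) / Real.log κ⁻¹)) →
    ∀ g : UnitAddTorus (Fin 2) → EuclideanSpace ℝ (Fin 2),
      Torus.IsSmooth g → Torus.IsDivFree g → Torus.HasZeroMean g →
      ∀ (ν : ℕ → ℝ) (v₀ : ℕ → UnitAddTorus (Fin 2) → EuclideanSpace ℝ (Fin 2))
        (v : ℕ → ℝ → UnitAddTorus (Fin 2) → EuclideanSpace ℝ (Fin 2)),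
        (∀ j, 0 < ν j) → Tendsto ν atTop (𝓝 0) →
        (∀ j, Torus.IsGlobalLerayHopf (ν j) (fun _ => g) (v₀ j) (v j)) →
        (∃ E : ℝ, ∀ j, meanEnergy (v j) ≤ E) →
        Tendsto (fun j => longTimeAvgSup (fun t => Real.sqrt (Torus.eGradNormSq (v j t)).toReal) /
          Real.log (ν j)⁻¹) atTop (𝓝 0) →
        ∀ h : UnitAddTorus (Fin 2) → ℝ, Torus.IsSmooth h → Torus.HasZeroMean h →
        ∀ S : ℝ, 0 < S → ∀ ϑ : ℕ → ℝ → ℝ → UnitAddTorus (Fin 2) → ℝ,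
          (∀ j (s : ℝ), 0 < s →
            Torus.IsWeakScalarTransportOn (S + 1) (ν j) (fun τ => v j (s + τ)) h (ϑ j s)) →
          Tendsto (fun j => longTimeAvgSup
            (fun s => (Torus.eScalarDissipation (ν j) (ϑ j s) 0 S).toReal)) atTop (𝓝 0) := by
  intro hEngine g hgs _hgd hgz ν v₀ v hν hν0 hLH _hE hsub h hhs _hhz S hS ϑ hrel
  -- sup-norm bounds of the profile on the compact torus
  obtain ⟨H, hH⟩ : ∃ H : ℝ, ∀ x, |h x| ≤ H := by
    obtain ⟨H, hH⟩ :=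
      hhs.continuous.bounded_above_of_compact_support (HasCompactSupport.of_compactSpace h)
    exact ⟨H, fun x => (Real.norm_eq_abs (h x)) ▸ hH x⟩
  obtain ⟨L, hL⟩ : ∃ L : ℝ, ∀ x, ‖Torus.gradient h x‖ ≤ L :=
    hhs.gradient.continuous.bounded_above_of_compact_support (HasCompactSupport.of_compactSpace _)
  -- the engine constants for the maximal window `T₀ = S + 1`
  obtain ⟨κ₀, C, hκ₀, hκ₀1, hC, hmain⟩ := hEngine H L (S + 1) (by linarith)
  -- notation: `ℓ j = log(1/ν_j)`, `Ψ j = ⟨‖∇v_j‖₂⟩`, the bound `R j`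
  set ℓ : ℕ → ℝ := fun j => Real.log (ν j)⁻¹ with hℓ
  set Ψ : ℕ → ℝ := fun j =>
    longTimeAvgSup (fun t => Real.sqrt (Torus.eGradNormSq (v j t)).toReal) with hΨ
  set R : ℕ → ℝ := fun j => C / ℓ j * (2 * (S + 1) * (Ψ j + 1) + 1) with hR
  -- `1/ℓ_j → 0` and `Ψ_j/ℓ_j → 0`, hence `R_j → 0`
  have hν0' : Tendsto ν atTop (𝓝[>] 0) :=
    tendsto_nhdsWithin_iff.2 ⟨hν0, Eventually.of_forall fun j => hν j⟩
  have hℓtop : Tendsto ℓ atTop atTop :=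
    Real.tendsto_log_atTop.comp (tendsto_inv_nhdsGT_zero.comp hν0')
  have hℓinv : Tendsto (fun j => (ℓ j)⁻¹) atTop (𝓝 0) := tendsto_inv_atTop_zero.comp hℓtop
  have hΨℓ : Tendsto (fun j => Ψ j / ℓ j) atTop (𝓝 0) := hsub
  have hRt : Tendsto R atTop (𝓝 0) := by
    have h1 : Tendsto (fun j => C * (2 * (S + 1) * (Ψ j / ℓ j) + (2 * (S + 1) + 1) * (ℓ j)⁻¹))
        atTop (𝓝 (C * (2 * (S + 1) * 0 + (2 * (S + 1) + 1) * 0))) :=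
      ((hΨℓ.const_mul _).add (hℓinv.const_mul _)).const_mul C
    rw [mul_zero, mul_zero, add_zero, mul_zero] at h1
    refine h1.congr fun j => ?_
    simp only [hR]
    ring
  -- eventually `ν_j ≤ κ₀`, and then the per-drift bound applies
  have hevκ : ∀ᶠ j in atTop, ν j ≤ κ₀ := hν0.eventually_le_const hκ₀
  refine squeeze_zero' (Eventually.of_forall fun j =>
    longTimeAvgSup_nonneg fun s => ENNReal.toReal_nonneg) ?_ hRt
  filter_upwards [hevκ] with j hj
  exact longTimeAvgSup_release_le hκ₀1 hC hS hmain (hν j) hj hgs hgz (hLH j) hhs hH hL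
    (fun s hs => hrel j s hs)

end Summit.AnomalousDissipation.AnomalousDissipation.Theorems.TwohalfdNeg.QuietOfSubLog
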